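import Summits.BirchSwinnertonDyer.BirchSwinnertonDyer.Theorems.KimAtThreeKolyvaginCertificateDictionary
import Summits.BirchSwinnertonDyer.Rank1Residual.Additive.KuriharaNumberModulusReduction
import HarnessLib

/-!
# Route `KimAtThreeKolyvagin` (rung W2), crux `DeepUpperAtThree`: GLUE from per-depth Kurihara-number
# witnesses (the output of the supply ledger) to the crux's conclusion at a row (general `p`)

Cell `bsd-addord`, seat `bsd-addord-w2-c3` (D-0074 row B6), item `stmt-BirchSwinnertonDyer-19076`.
The two ledgers `KimAtThreeDeepUpperLedger` (`#Sel_{p^K}(E/ℚ) ∣ p^{t+v−α}` at the empty level, from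
the STUB port) and `KimAtThreeDeepUpperSupplyLedger` (`δ̃_n = p^{α−t} · unit` in `ℤ/p^K` at a good
core vertex `n` of depth `K`) produce, at every deep level `K`, an EXPLICIT Kurihara number
`δ̃^{(K)}_n(ψ) = p^γ · (unit)` with `γ = α − t ≤ v − s` (`v = ∂⁽⁰⁾(δ̃)`, `s = ord_p #Sel_{p^K} = ord_p #Ш(p)`
at deep `K`). This file turns such witnesses into the `∂`-currency conclusion of crux 19076 at the row
(kim3's certificate dictionary `deepUpper_conclusion_iff_certificateSupply`, p415298):

* `not_dvd_den_ratPlusSymbol_of_integral` — the crux's integrality binder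
  (`[r]⁺_f ≠ 0 → 0 ≤ ord_p [r]⁺_f`) gives `p ∤ den [r]⁺_f` for every `r` (so Kurihara numbers reduce
  compatibly in the modulus, `KuriharaReduction.castHom_kuriharaNumber_pow`);
* `not_kuriharaDivisibleAt_of_kuriharaNumber_eq_pow_mul_unit` — a Kurihara number of EXACT valuation
  `γ < K` modulo `p^K` (`= p^γ · unit`) at a level `n ∈ 𝒩_{γ+1}` is a certificate of depth `γ + 1`:
  `δ̃_n ∉ p^{γ+1}ℤ_p/I_n` (reduce to `ℤ/p^{γ+1}`, where `p^γ · unit ≠ 0`);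
* **`deepUpper_conclusion_of_supplyWitnesses`** — if `∂⁽⁰⁾(δ̃) = a`, `s ≤ a`, and for some `i` every
  depth `k > a − s` carries a cyclic `n ∈ 𝒩_k` with `ν(n) = i` and a witness
  `δ̃^{(K)}_n(ψ) = p^γ · unit`, `γ ≤ a − s`, `γ < K`, then `∃ d, ∂^{(∞)}_{deep}(δ̃) = d ∧ s + d ≤ ∂⁽⁰⁾(δ̃)` —
  with `s = ord₃ #Ш(3)` the conclusion of crux 19076 at the row;
* `deepUpper_conclusion_of_ledgerWitnesses` — the same with the witness in the ledgers' own letters: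
  `γ = α − t`, `t ≤ α < K`, and the upper ledger's `s + α ≤ t + a`.

Pure bookkeeping: no fact, no port, nothing asserted about any curve; the Galois-cohomological
witnesses (ports: STUB@∅, good core vertices, `KatoKuriharaPortThreeAt`) are the END theorem's inputs.
[cite: Kim2022StructureSelmer, §1.4.3 and §1.5.1 (PDF p. 7), Thm. 1.9 (6)] [cite: MazurRubin2004, Def. 4.5.7, Thm. 5.2.12 (i), (v)]
[cite: Kim2025RefinedTNC, Thm 1.1, Lemma 5.2]
-/

set_option autoImplicit false
-- the Theorems namespace of a single-conjunct summit repeats the summit name by design (D-0017)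
set_option linter.dupNamespace false

noncomputable section

open scoped MatrixGroups ModularForm Classical

open CongruenceSubgroup WeierstrassCurve Literature.NumberTheory.EllipticCurves
  Literature.NumberTheory.EllipticCurves.ModularForms

namespace Summit.BirchSwinnertonDyer.BirchSwinnertonDyer.Theorems.KimAtThreeDeepUpperSupplyGlue

open Summit.BirchSwinnertonDyer.Rank1Residual.Additive
open Summit.BirchSwinnertonDyer.BirchSwinnertonDyer.Theorems.KimAtThreeKolyvaginCertificateDictionary

variable (W : WeierstrassCurve ℚ) [W.IsGloballyMinimal] (p : ℕ) [hp : Fact p.Prime] {N : ℕ}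
  (f : CuspForm (Gamma0 N) 2)

omit [W.IsGloballyMinimal] in
/-- **Integrality of the plus symbols ⟹ `p ∤ den [r]⁺_f` for every `r`** (the crux's binder
`[r]⁺_f ≠ 0 → 0 ≤ ord_p [r]⁺_f`; a vanishing symbol has denominator `1`). [folklore] -/
theorem not_dvd_den_ratPlusSymbol_of_integral
    (hint : ∀ r : ℚ, ratPlusSymbol f r ≠ 0 → 0 ≤ padicValRat p (ratPlusSymbol f r)) (r : ℚ) :
    ¬ p ∣ (ratPlusSymbol f r).den := by
  by_cases h0 : ratPlusSymbol f r = 0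
  · rw [h0, Rat.den_zero, Nat.dvd_one]
    exact hp.out.one_lt.ne'
  · apply not_dvd_den_of_norm_ratCast_le_one
    rw [Padic.norm_le_one_iff_val_nonneg, Padic.valuation_ratCast]
    exact hint _ h0

/-- **A Kurihara number of exact valuation `γ` modulo `p^K` is a certificate of depth `γ + 1`.** For
`n ∈ 𝒩_{γ+1}(E,p)` (`γ < K`), surjective discrete logarithms `ψ` modulo `p^K`, `p`-integral symbols
`[a/n]⁺_f`, and `δ̃^{(K)}_n(ψ) = p^γ · w` with `w` a unit of `ℤ/p^K`: `δ̃_n ∉ p^{γ+1}ℤ_p/I_n`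
(`¬ KuriharaDivisibleAt W p f n (γ + 1)`), because the reduction of `δ̃^{(K)}_n(ψ)` to `ℤ/p^{γ+1}` is
`δ̃^{(γ+1)}_n(ψ mod p^{γ+1}) = p^γ · (unit) ≠ 0`. [cite: Kim2022StructureSelmer, §1.4.3 and §1.5.1 (PDF p. 7)] -/
theorem not_kuriharaDivisibleAt_of_kuriharaNumber_eq_pow_mul_unit {n K γ : ℕ} [NeZero n]
    (hγK : γ < K) (hn : Kato.IsKolyvaginProduct W p (γ + 1) n)
    (ψ : (ℓ : ℕ) → (ZMod ℓ)ˣ →* Multiplicative (ZMod (p ^ K)))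
    (hψ : ∀ ℓ ∈ n.primeFactors, Function.Surjective (ψ ℓ))
    (hden : ∀ a : (ZMod n)ˣ, ¬ p ∣ (ratPlusSymbol f (((a : ZMod n).val : ℚ) / n)).den)
    (w : (ZMod (p ^ K))ˣ)
    (hδ : kuriharaNumber f (p ^ K) n ψ = ((p ^ γ : ℕ) : ZMod (p ^ K)) * (w : ZMod (p ^ K))) :
    ¬ KuriharaDivisibleAt W p f n (γ + 1) := by
  have hle : γ + 1 ≤ K := hγK
  have hred := KuriharaReduction.castHom_kuriharaNumber_pow f p hle n ψ hden
  have hne : kuriharaNumber f (p ^ (γ + 1)) n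
      (fun ℓ => (ZMod.castHom (pow_dvd_pow p hle) (ZMod (p ^ (γ + 1)))).toAddMonoidHom.toMultiplicative.comp
        (ψ ℓ)) ≠ 0 := by
    rw [← hred, hδ, map_mul, map_natCast]
    obtain ⟨w', hw'⟩ := (Units.isUnit w).map (ZMod.castHom (pow_dvd_pow p hle) (ZMod (p ^ (γ + 1))))
    rw [← hw']
    intro h0
    have h1 : ((p ^ γ : ℕ) : ZMod (p ^ (γ + 1))) = 0 := by
      have := congrArg (· * ((w'⁻¹ : (ZMod (p ^ (γ + 1)))ˣ) : ZMod (p ^ (γ + 1)))) h0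
      simpa only [mul_assoc, Units.mul_inv, mul_one, zero_mul] using this
    rw [ZMod.natCast_eq_zero_iff] at h1
    have h2 : p ^ γ < p ^ (γ + 1) := Nat.pow_lt_pow_right hp.out.one_lt (by omega)
    exact absurd (Nat.le_of_dvd (pow_pos hp.out.pos γ) h1) (not_le.mpr h2)
  exact not_kuriharaDivisibleAt_of_kuriharaNumber_ne_zero W p f le_rfl hn _
    (fun ℓ hℓ => KuriharaReduction.surjective_castHom_comp p hle (hψ ℓ hℓ)) hne

/-- **Per-depth supply witnesses ⟹ crux 19076's conclusion at the row.** On a row with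
`∂⁽⁰⁾(δ̃) = a`, `p`-integral plus symbols and `s ≤ a`: if for some `i` EVERY depth `k > a − s` carries
a cyclic level `n ∈ 𝒩_k(E,p)` with `ν(n) = i` and an explicit Kurihara number
`δ̃^{(K)}_n(ψ) = p^γ · unit` with `γ ≤ a − s`, `γ < K` (surjective `ψ` modulo `p^K`), then
`∃ d, ∂^{(∞)}_{deep}(δ̃) = d ∧ s + d ≤ ∂⁽⁰⁾(δ̃)`. With `s = ord₃ #Ш(E/ℚ)(3)` and the witnesses of the two
ledgers (`γ = α − t`, one good core vertex per depth) this is the conclusion of crux 19076 at the row.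
[cite: MazurRubin2004, Def. 4.5.7, Thm. 5.2.12 (i), (v)] [cite: Kim2025RefinedTNC, Thm 1.1, Lemma 5.2] -/
theorem deepUpper_conclusion_of_supplyWitnesses
    (hint : ∀ r : ℚ, ratPlusSymbol f r ≠ 0 → 0 ≤ padicValRat p (ratPlusSymbol f r))
    {a : ℕ} (ha : kuriharaPartial W p f 0 = a) {s : ℕ} (hs : s ≤ a) (i : ℕ)
    (hW : ∀ k, a - s < k → ∃ (n : ℕ) (_ : NeZero n), IsCyclicKolyvaginLevel W p n ∧
      Kato.IsKolyvaginProduct W p k n ∧ n.primeFactors.card = i ∧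
      ∃ (K γ : ℕ) (ψ : (ℓ : ℕ) → (ZMod ℓ)ˣ →* Multiplicative (ZMod (p ^ K))) (w : (ZMod (p ^ K))ˣ),
        γ ≤ a - s ∧ γ < K ∧ (∀ ℓ ∈ n.primeFactors, Function.Surjective (ψ ℓ)) ∧
        kuriharaNumber f (p ^ K) n ψ = ((p ^ γ : ℕ) : ZMod (p ^ K)) * (w : ZMod (p ^ K))) :
    ∃ d : ℕ, kuriharaPartialDeepInfty W p f = d ∧ ((s + d : ℕ) : ℕ∞) ≤ kuriharaPartial W p f 0 := by
  refine (deepUpper_conclusion_iff_certificateSupply W p f ha s).mpr ⟨hs, i, fun k hk => ?_⟩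
  obtain ⟨n, _, hcyc, hn, hν, K, γ, ψ, w, hγ, hγK, hψ, hδ⟩ := hW k hk
  refine ⟨n, hcyc, hn, hν, fun hdiv => ?_⟩
  have hn' : Kato.IsKolyvaginProduct W p (γ + 1) n := hn.mono (by omega)
  exact not_kuriharaDivisibleAt_of_kuriharaNumber_eq_pow_mul_unit W p f hγK hn' ψ hψ
    (fun b => not_dvd_den_ratPlusSymbol_of_integral p f hint _) w hδ (hdiv.anti (by omega))

/-- **The same, in the ledgers' letters.** Witness per depth `k > a − s`: a cyclic `n ∈ 𝒩_k` with
`ν(n) = i`, a modulus `p^K`, the index `α` and torsion exponent `t` with `t ≤ α < K`, the upper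
ledger's inequality `s + α ≤ t + a` (`#Sel_{p^K} ∣ p^{t+v−α}`, `v = a`, `s = ord_p #Sel_{p^K}`), and the
supply ledger's `δ̃^{(K)}_n(ψ) = p^{α−t} · unit`. Then `∃ d, ∂^{(∞)}_{deep} = d ∧ s + d ≤ ∂⁽⁰⁾`.
[cite: Kim2022StructureSelmer, Thm. 1.9 (6), Thm. 3.13] [cite: Kim2025RefinedTNC, Thm 1.1] -/
theorem deepUpper_conclusion_of_ledgerWitnesses
    (hint : ∀ r : ℚ, ratPlusSymbol f r ≠ 0 → 0 ≤ padicValRat p (ratPlusSymbol f r))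
    {a : ℕ} (ha : kuriharaPartial W p f 0 = a) {s : ℕ} (hs : s ≤ a) (i : ℕ)
    (hW : ∀ k, a - s < k → ∃ (n : ℕ) (_ : NeZero n), IsCyclicKolyvaginLevel W p n ∧
      Kato.IsKolyvaginProduct W p k n ∧ n.primeFactors.card = i ∧
      ∃ (K α t : ℕ) (ψ : (ℓ : ℕ) → (ZMod ℓ)ˣ →* Multiplicative (ZMod (p ^ K))) (w : (ZMod (p ^ K))ˣ),
        t ≤ α ∧ α < K ∧ s + α ≤ t + a ∧ (∀ ℓ ∈ n.primeFactors, Function.Surjective (ψ ℓ)) ∧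
        kuriharaNumber f (p ^ K) n ψ = ((p ^ (α - t) : ℕ) : ZMod (p ^ K)) * (w : ZMod (p ^ K))) :
    ∃ d : ℕ, kuriharaPartialDeepInfty W p f = d ∧ ((s + d : ℕ) : ℕ∞) ≤ kuriharaPartial W p f 0 := by
  refine deepUpper_conclusion_of_supplyWitnesses W p f hint ha hs i fun k hk => ?_
  obtain ⟨n, hn0, hcyc, hn, hν, K, α, t, ψ, w, htα, hαK, hsα, hψ, hδ⟩ := hW k hk
  exact ⟨n, hn0, hcyc, hn, hν, K, α - t, ψ, w, by omega, by omega, hψ, hδ⟩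

/-! ### Appended 2026-08-26 (same seat): witnesses of BOUNDED `ν` suffice (pigeonhole over `ν ≤ B`) -/

/-- **Pigeonhole on `ν`.** If every depth `k > k₀` carries a witness level whose number of prime
factors is at most `B` (`P k n` any property MONOTONE in the depth: a witness at depth `K ≥ k` is a
witness at depth `k`, as for `n ∈ 𝒩_K ⊆ 𝒩_k`), then for SOME fixed `i ≤ B` every depth `k > k₀`
carries a witness with exactly `i` prime factors. (Memo `kim3/KIM3-PROOF.md` §5 Step 6 (N2): the good
core vertices have `ν ∈ {r, r+1}`; one value occurs at arbitrarily deep levels.) [folklore] -/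
theorem exists_fixed_card_of_bounded {P : ℕ → ℕ → Prop} (hmono : ∀ k K n, k ≤ K → P K n → P k n)
    {k₀ B : ℕ} (hW : ∀ k, k₀ < k → ∃ n, n.primeFactors.card ≤ B ∧ P k n) :
    ∃ i, i ≤ B ∧ ∀ k, k₀ < k → ∃ n, n.primeFactors.card = i ∧ P k n := by
  by_contra hcon
  push Not at hcon
  -- for each `i ≤ B` a depth `K i > k₀` with no witness of `ν = i`
  choose K hK hnone using fun i (hi : i ≤ B) => hcon i hi
  -- a common depth beyond all of them
  let M : ℕ := (Finset.range (B + 1)).sup (fun i => if h : i ≤ B then K i h else 0) + k₀ + 1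
  have hM : k₀ < M := by omega
  obtain ⟨n, hnB, hPn⟩ := hW M hM
  have hi : n.primeFactors.card ≤ B := hnB
  have hKle : K _ hi ≤ M := by
    have : (if h : n.primeFactors.card ≤ B then K _ h else 0) ≤
        (Finset.range (B + 1)).sup (fun i => if h : i ≤ B then K i h else 0) :=
      Finset.le_sup (f := fun i => if h : i ≤ B then K i h else 0)
        (Finset.mem_range.mpr (Nat.lt_succ_of_le hi))
    rw [dif_pos hi] at this
    omega
  exact hnone _ hi n rfl (hmono _ _ _ hKle hPn)

/-- **Per-depth supply witnesses of BOUNDED `ν` ⟹ crux 19076's conclusion at the row.** As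
`deepUpper_conclusion_of_supplyWitnesses`, but the witness level at depth `k` is only required to have
`ν(n) ≤ B` (the good core vertices of the Kato-side construction have `ν ∈ {r, r+1}`,
`r = dim_{𝔽₃} Sel₃`, Mazur–Rubin Cor. 4.1.9 shape); the fixed `i` demanded by
`deepUpper_conclusion_iff_certificateSupply` is extracted by `exists_fixed_card_of_bounded`, a witness at
depth `K ≥ k` serving depth `k` (`𝒩_K ⊆ 𝒩_k`). [cite: MazurRubin2004, Cor. 4.1.9, Thm. 5.2.12 (i), (v)]
[cite: Kim2025RefinedTNC, Thm 1.1, Lemma 5.2] -/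
theorem deepUpper_conclusion_of_supplyWitnesses_bounded
    (hint : ∀ r : ℚ, ratPlusSymbol f r ≠ 0 → 0 ≤ padicValRat p (ratPlusSymbol f r))
    {a : ℕ} (ha : kuriharaPartial W p f 0 = a) {s : ℕ} (hs : s ≤ a) (B : ℕ)
    (hW : ∀ k, a - s < k → ∃ (n : ℕ) (_ : NeZero n), IsCyclicKolyvaginLevel W p n ∧
      Kato.IsKolyvaginProduct W p k n ∧ n.primeFactors.card ≤ B ∧
      ∃ (K γ : ℕ) (ψ : (ℓ : ℕ) → (ZMod ℓ)ˣ →* Multiplicative (ZMod (p ^ K))) (w : (ZMod (p ^ K))ˣ),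
        γ ≤ a - s ∧ γ < K ∧ (∀ ℓ ∈ n.primeFactors, Function.Surjective (ψ ℓ)) ∧
        kuriharaNumber f (p ^ K) n ψ = ((p ^ γ : ℕ) : ZMod (p ^ K)) * (w : ZMod (p ^ K))) :
    ∃ d : ℕ, kuriharaPartialDeepInfty W p f = d ∧ ((s + d : ℕ) : ℕ∞) ≤ kuriharaPartial W p f 0 := by
  -- the witness property at depth `k`, monotone in `k`
  let P : ℕ → ℕ → Prop := fun k n => ∃ (_ : NeZero n), IsCyclicKolyvaginLevel W p n ∧
      Kato.IsKolyvaginProduct W p k n ∧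
      ∃ (K γ : ℕ) (ψ : (ℓ : ℕ) → (ZMod ℓ)ˣ →* Multiplicative (ZMod (p ^ K))) (w : (ZMod (p ^ K))ˣ),
        γ ≤ a - s ∧ γ < K ∧ (∀ ℓ ∈ n.primeFactors, Function.Surjective (ψ ℓ)) ∧
        kuriharaNumber f (p ^ K) n ψ = ((p ^ γ : ℕ) : ZMod (p ^ K)) * (w : ZMod (p ^ K))
  have hmono : ∀ k K n, k ≤ K → P K n → P k n := by
    rintro k K n hkK ⟨hn0, hcyc, hn, rest⟩
    exact ⟨hn0, hcyc, hn.mono hkK, rest⟩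
  have hW' : ∀ k, a - s < k → ∃ n, n.primeFactors.card ≤ B ∧ P k n := by
    intro k hk
    obtain ⟨n, hn0, hcyc, hn, hB, rest⟩ := hW k hk
    exact ⟨n, hB, hn0, hcyc, hn, rest⟩
  obtain ⟨i, -, hi⟩ := exists_fixed_card_of_bounded hmono hW'
  refine deepUpper_conclusion_of_supplyWitnesses W p f hint ha hs i fun k hk => ?_
  obtain ⟨n, hν, hn0, hcyc, hn, rest⟩ := hi k hk
  exact ⟨n, hn0, hcyc, hn, hν, rest⟩

end Summit.BirchSwinnertonDyer.BirchSwinnertonDyer.Theorems.KimAtThreeDeepUpperSupplyGlue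

end
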